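import Literature.AlgebraicGeometry.Resolution.InseparableLocalUniformization
import Literature.AlgebraicGeometry.Resolution.SeparatingTranscendenceBasis
import Literature.AlgebraicGeometry.Resolution.NormalizationOfVarieties
import Mathlib.RingTheory.KrullDimension.Zero
import Mathlib.RingTheory.Localization.AtPrime.Basic
import Mathlib.RingTheory.LocalRing.ResidueField.Basic
import Mathlib.RingTheory.RegularLocalRing.Defs
import Mathlib.RingTheory.Smooth.Locus
import Mathlib.RingTheory.Localization.Integral
import Mathlib.RingTheory.Algebraic.Integral
import Mathlib.RingTheory.FiniteType
import HarnessLib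

/-!
# Inseparable local uniformization in height zero (the trivial valuation) — proved

Topic: `Literature/AlgebraicGeometry/Resolution`. Companion to `LocalUniformization.lean` (the
named fact `Temkin2013` = Temkin 2013, Thm. 1.3.2, weak form) and
`InseparableLocalUniformization.lean` (the corrected relative rendering
`Temkin2013RelConclusion` / `Temkin2013Relative`, its height filtration `Temkin2013RelHeightLE n`
and the assembly of Thm. 1.3.2 from the height-one case and the induction on the height).
All section/page numbers are those of the journal version = arXiv:0804.1554v3.

This file PROVES the base layer of that filtration, `Temkin2013RelHeightLE 0`: Thm. 1.3.2 for
the trivial valuation ring `K° = K` (height `0` = Krull dimension `0`). In the paper this is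
the first sentence of the proof of Thm. 4.1.1 (p. 47): "Note that the case of valued fields of
height zero reduces to the classical theorem on the existence of a separating transcendence
basis". In detail (this file + `SeparatingTranscendenceBasis.lean`):

1. `valuationSubring_eq_top_of_ringKrullDim_le_zero`: a valuation ring of height `0` is `K`.
2. `exists_purelyInseparable_isSeparablyGenerated` (`SeparatingTranscendenceBasis.lean`): there
   are finite purely inseparable `l/k` and `L = lK ⊇ K` with `L/l` separably generated, hence
   `L` formally smooth over `l`.
3. `temkin2013RelConclusion_top`: with `X' = X = Spec A`, `L° = L`, and `Nr_L(X) = Spec N` for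
   the integral closure `N` of `A` in `L` — finitely generated over `k` by E. Noether's
   finiteness theorem, used through the named fact `NoetherFiniteIntegralClosure`
   (`NormalizationOfVarieties.lean`, Liu 2002, Prop. 4.1.27), the only hypothesis left — the
   centre of `L°` on `Nr_L(X)` is the generic point (`centreIdeal_top_eq_bot`), whose local
   ring is the field `L`: formally smooth over `l`, with residue field `L` formally smooth over
   `l` ("simple"), and regular (`local_conclusions_of_eq_bot`).

Besides being the base of the induction on the height, this certifies that the corrected
rendering `Temkin2013RelConclusion` is satisfiable in exactly the situation (`K = k(t)`,
`K° = K`) where the tree's original rendering `Temkin2013Rel` was refuted (`not_temkin2013Rel`).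

## Main results

* `Temkin2013RelHeightLE.zero (hN : NoetherFiniteIntegralClosure) : Temkin2013RelHeightLE 0` —
  PROVED.
* `temkin2013RelConclusion_top`, `local_conclusions_of_eq_bot`, `centreIdeal_top_eq_bot`,
  `valuationSubring_eq_top_of_ringKrullDim_le_zero`, `isFractionRing_localizationAtPrime_of_eq_bot`
  — PROVED auxiliary statements.

## Sources

* M. Temkin, *Inseparable local uniformization*, J. Algebra 373 (2013) 65–119 =
  arXiv:0804.1554v3: Thm. 1.3.2 (p. 3), "simple" (p. 4), height = Krull dimension of `K°`
  (§2.1, p. 9), proof of Thm. 4.1.1, first sentence (p. 47).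
* Q. Liu, *Algebraic Geometry and Arithmetic Curves*, OUP (2002), Prop. 4.1.27 (finiteness of
  the integral closure; the named fact `NoetherFiniteIntegralClosure`).
-/

noncomputable section

open IntermediateField Polynomial

namespace Literature.AlgebraicGeometry.Resolution

universe u

/-! ## Height zero: the trivial valuation -/

/-- A valuation ring of Krull dimension `≤ 0` of a field `K` is all of `K` (a valuation ring
that is a field contains, with every element it misses, the inverse of that element, which is
then a unit of it). [folklore] -/
theorem valuationSubring_eq_top_of_ringKrullDim_le_zero {K : Type u} [Field K]
    (O : ValuationSubring K) (h : ringKrullDim O ≤ 0) : O = ⊤ := by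
  have hK : Ring.KrullDimLE 0 O := (Ring.krullDimLE_iff (R := O)).mpr (by exact_mod_cast h)
  have hf : IsField O := Ring.KrullDimLE.isField_of_isDomain
  refine top_le_iff.mp fun x _ => ?_
  rcases O.mem_or_inv_mem x with hx | hx
  · exact hx
  · by_cases hx0 : x = 0
    · simp [hx0]
    · have hne : (⟨x⁻¹, hx⟩ : O) ≠ 0 := by
        intro h0
        apply hx0
        have : (x⁻¹ : K) = 0 := congrArg Subtype.val h0
        simpa using this
      obtain ⟨y, hy⟩ := hf.mul_inv_cancel hne
      have hyx : (y : K) = x := by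
        have : (x⁻¹ : K) * y = 1 := by simpa using congrArg Subtype.val hy
        calc (y : K) = x * (x⁻¹ * y) := by field_simp
          _ = x := by rw [this, mul_one]
      exact hyx ▸ y.2

/-- For the prime `P = ⊥` of a domain `R`, the localisation `R_P` is the fraction field of `R`.
[folklore] -/
theorem isFractionRing_localizationAtPrime_of_eq_bot {R : Type*} [CommRing R] [IsDomain R]
    (P : Ideal R) [P.IsPrime] (hP : P = ⊥) : IsFractionRing R (Localization.AtPrime P) := by
  subst hP
  simpa [Ideal.primeCompl_bot] using Localization.isLocalization (M := (⊥ : Ideal R).primeCompl)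

/-- The centre of the trivial valuation ring `⊤ = L` of `L` on any subalgebra `N ⊆ L` is the
zero ideal (every non-zero element of `N` is a unit of `L`). [folklore] -/
theorem centreIdeal_top_eq_bot {F L : Type u} [Field F] [Field L] [Algebra F L]
    (N : Subalgebra F L) (hN : N.toSubring ≤ (⊤ : ValuationSubring L).toSubring) :
    centreIdeal N ⊤ hN = ⊥ := by
  refine le_bot_iff.mp fun y hy => ?_
  rw [Ideal.mem_bot]
  by_contra hy0
  have hyL : (y : L) ≠ 0 := fun h0 => hy0 (Subtype.ext (by simpa using h0))
  have hunit : IsUnit (Subring.inclusion hN y) := by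
    refine IsUnit.of_mul_eq_one ⟨(y : L)⁻¹, ValuationSubring.mem_top _⟩ ?_
    apply Subtype.ext
    change (y : L) * (y : L)⁻¹ = 1
    exact mul_inv_cancel₀ hyL
  exact (IsLocalRing.mem_maximalIdeal _ |>.mp hy) hunit

/-- **The three local conclusions of Thm. 1.3.2 at a centre which is the generic point.** Let
`N` be an `l`-subalgebra of a field `L` with `Frac N = L`, `L` formally smooth over `l`, and
`P = ⊥` the zero prime of `N`. Then `N_P ≅ L` is formally smooth over `l` (`N` is `l`-smooth at
`P`), the residue field of `N_P` (`≅ L`) is formally smooth over `l` (the point is simple), and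
`N_P` is a regular local ring (a field). [folklore] -/
theorem local_conclusions_of_eq_bot {l L : Type u} [Field l] [Field L] [Algebra l L]
    [Algebra.FormallySmooth l L] (N : Subalgebra l L) [IsFractionRing N L]
    (P : Ideal N) [P.IsPrime] (hP : P = ⊥) :
    Algebra.IsSmoothAt l P ∧
      Algebra.FormallySmooth l (IsLocalRing.ResidueField (Localization.AtPrime P)) ∧
      IsRegularLocalRing (Localization.AtPrime P) := by
  haveI : IsFractionRing N (Localization.AtPrime P) :=
    isFractionRing_localizationAtPrime_of_eq_bot P hP
  -- `L ≃ₐ[N] N_P`, both being fraction fields of `N`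
  let e : L ≃ₐ[N] Localization.AtPrime P :=
    IsLocalization.algEquiv (nonZeroDivisors N) L (Localization.AtPrime P)
  let el : L ≃ₐ[l] Localization.AtPrime P := e.restrictScalars l
  have hsm : Algebra.FormallySmooth l (Localization.AtPrime P) := Algebra.FormallySmooth.of_equiv el
  have hfield : IsField (Localization.AtPrime P) :=
    MulEquiv.isField (Field.toIsField L) e.symm.toMulEquiv
  refine ⟨hsm, ?_, ?_⟩
  · -- the residue field of the field `N_P` is `N_P`
    have hbot : IsLocalRing.maximalIdeal (Localization.AtPrime P) = ⊥ :=
      (IsLocalRing.isField_iff_maximalIdeal_eq).mp hfield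
    let r : Localization.AtPrime P →ₐ[l] IsLocalRing.ResidueField (Localization.AtPrime P) :=
      IsScalarTower.toAlgHom l _ _
    have hr : Function.Bijective r := by
      constructor
      · have hker : RingHom.ker (r : Localization.AtPrime P →+*
            IsLocalRing.ResidueField (Localization.AtPrime P)) = ⊥ := by
          change RingHom.ker (IsLocalRing.residue (Localization.AtPrime P)) = ⊥
          rw [IsLocalRing.ker_residue, hbot]
        exact (RingHom.injective_iff_ker_eq_bot _).mpr hker
      · exact Ideal.Quotient.mk_surjective
    exact Algebra.FormallySmooth.of_equiv (AlgEquiv.ofBijective r hr)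
  · letI : Field (Localization.AtPrime P) := hfield.toField
    exact IsRegularLocalRing.of_ringEquiv (R := L) e.toRingEquiv

/-- **Height zero, given the field-theoretic input.** Let `X = Spec A` be an affine model of the
trivial valuation ring `K° = K` of `K/k`, `L/K` finite purely inseparable and `l ≤ L` finite
purely inseparable over `k` with `L` formally smooth (= separable) over `l`. Then the conclusion
of Thm. 1.3.2 holds with `X' = X`, `L° = L` and `Nr_L(X) = Spec N`, `N` the integral closure of
`A` in `L` — a finitely generated `k`-algebra by E. Noether's finiteness theorem, the named fact
`NoetherFiniteIntegralClosure` of `NormalizationOfVarieties.lean` — : the centre of `L° = L` on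
`Nr_L(X)` is the generic point, at which `Nr_L(X)` is `l`-smooth, simple and regular because the
local ring is the field `L` (`local_conclusions_of_eq_bot`). [folklore] -/
theorem temkin2013RelConclusion_top (hN : NoetherFiniteIntegralClosure.{u})
    (k K : Type u) [Field k] [Field K] [Algebra k K]
    (A : Subalgebra k K) (hAfg : A.FG) (hAfr : IsFractionRing A K)
    (L : Type u) [Field L] [Algebra K L] [Algebra k L] [IsScalarTower k K L]
    [FiniteDimensional K L] [IsPurelyInseparable K L]
    (l : IntermediateField k L) [FiniteDimensional k l] [IsPurelyInseparable k l]
    [Algebra.FormallySmooth l L] :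
    Temkin2013RelConclusion k K ⊤ A := by
  classical
  haveI : IsFractionRing A K := hAfr
  haveI : Algebra.FiniteType k A := (Subalgebra.fg_iff_finiteType A).mp hAfg
  -- the integral closure of `A` in `L`, finite over `A` (E. Noether)
  haveI hNint : Module.Finite A (integralClosure A L) := hN k A K L
  have hft : Algebra.FiniteType k (integralClosure A L) :=
    Algebra.FiniteType.trans (S := A) inferInstance inferInstance
  -- elements of `l` are integral over `k ⊆ A`
  have hlint : ∀ c : l, IsIntegral A (algebraMap l L c) := fun c => by
    have h1 : IsIntegral k c := Algebra.IsIntegral.isIntegral c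
    exact (h1.map (IsScalarTower.toAlgHom k l L)).tower_top
  let N : Subalgebra l L :=
    { carrier := {x : L | IsIntegral A x}
      mul_mem' := fun ha hb => ha.mul hb
      one_mem' := isIntegral_one
      add_mem' := fun ha hb => ha.add hb
      zero_mem' := isIntegral_zero
      algebraMap_mem' := hlint }
  have hNtop : N.toSubring ≤ (⊤ : ValuationSubring L).toSubring := fun _ _ =>
    ValuationSubring.mem_top _
  -- the carrier is the integral closure of the image of `A`
  let φ : K →ₐ[k] L := IsScalarTower.toAlgHom k K L
  have hcarrier : (N : Set L) = {x : L | IsIntegral (A.map φ) x} := by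
    let e : A ≃ₐ[k] A.map φ := Subalgebra.equivMapOfInjective A φ (algebraMap K L).injective
    have hcomp : (algebraMap (A.map φ) L).comp (e : A →+* A.map φ) =
        (RingHom.id L).comp (algebraMap A L) := RingHom.ext fun _ => rfl
    have hcomp' : (algebraMap A L).comp (e.symm : A.map φ →+* A) =
        (RingHom.id L).comp (algebraMap (A.map φ) L) := by
      refine RingHom.ext fun x => ?_
      obtain ⟨y, rfl⟩ := e.surjective x
      simp only [RingHom.coe_comp, RingHom.coe_coe, Function.comp_apply, AlgEquiv.symm_apply_apply,
        RingHom.id_apply]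
      exact (congrArg (fun g : A →+* L => g y) hcomp).symm
    ext x
    exact ⟨fun hx => IsIntegral.map_of_comp_eq (e : A →+* A.map φ) (RingHom.id L) hcomp hx,
      fun hx => IsIntegral.map_of_comp_eq (e.symm : A.map φ →+* A) (RingHom.id L) hcomp' hx⟩
  -- `N` is finitely generated over `k`
  have hNfg : (N.restrictScalars k).FG := by
    rw [Subalgebra.fg_iff_finiteType]
    let e : integralClosure A L ≃ₐ[k] N.restrictScalars k :=
      { toFun := fun x => ⟨x.1, x.2⟩
        invFun := fun x => ⟨x.1, x.2⟩
        left_inv := fun _ => rfl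
        right_inv := fun _ => rfl
        map_mul' := fun _ _ => rfl
        map_add' := fun _ _ => rfl
        commutes' := fun _ => rfl }
    exact hft.equiv e
  -- `Frac N = L`
  haveI hNfr : IsFractionRing N L := by
    refine IsFractionRing.of_field N L fun z => ?_
    haveI : Algebra.IsAlgebraic K L := Algebra.IsAlgebraic.of_finite K L
    have hz : IsAlgebraic A z :=
      (IsFractionRing.isAlgebraic_iff A K L).mpr (Algebra.IsAlgebraic.isAlgebraic z)
    obtain ⟨a, ha0, hint⟩ := hz.exists_integral_multiple
    refine ⟨⟨a • z, hint⟩, ⟨algebraMap A L a, isIntegral_algebraMap⟩, ?_⟩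
    have ha' : (algebraMap A L a) ≠ 0 :=
      (map_ne_zero_iff _ (FaithfulSMul.algebraMap_injective A L)).mpr ha0
    change z = (a • z) / algebraMap A L a
    rw [Algebra.smul_def, eq_div_iff ha', mul_comm]
  -- the centre is the generic point; conclude
  have hcen : centreIdeal N ⊤ hNtop = ⊥ := centreIdeal_top_eq_bot N hNtop
  obtain ⟨h1, h2, h3⟩ := local_conclusions_of_eq_bot N (centreIdeal N ⊤ hNtop) hcen
  have hcomap : (⊤ : ValuationSubring L).comap (algebraMap K L) = ⊤ := by
    ext x
    simp [ValuationSubring.mem_comap, ValuationSubring.mem_top]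
  exact ⟨L, inferInstance, inferInstance, inferInstance, inferInstance, inferInstance, inferInstance,
    l, inferInstance, inferInstance, A, le_rfl, fun _ _ => ValuationSubring.mem_top _,
    hAfg, hAfr, ⊤, hcomap, N, hNtop, hcarrier, hNfg, hNfr, h1, h2, h3⟩

/-- **Temkin's Thm. 1.3.2 in height zero** — PROVED (modulo E. Noether's finiteness of the
integral closure, the named fact `NoetherFiniteIntegralClosure`, Liu 2002, Prop. 4.1.27): for
`K/k` finitely generated, the TRIVIAL valuation ring `K° = K` (the valuation rings of height
`= ringKrullDim K° ≤ 0`) and any affine model `X = Spec A` of `K°`, the corrected conclusion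
`Temkin2013RelConclusion k K K° A` of Thm. 1.3.2 holds. Temkin 2013, proof of Thm. 4.1.1
(arXiv:0804.1554v3, p. 47): "Note that the case of valued fields of height zero reduces to the
classical theorem on the existence of a separating transcendence basis" — here: after a finite
purely inseparable extension of the constants `l/k`, `L = lK` is separably generated, hence
formally smooth, over `l` (`exists_purelyInseparable_isSeparablyGenerated`,
`SeparatingTranscendenceBasis.lean`), and then `temkin2013RelConclusion_top` applies. This is
the base of the induction on the height and certifies that the corrected rendering
`Temkin2013RelConclusion` is satisfiable exactly where the tree's `Temkin2013Rel` was refuted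
(`not_temkin2013Rel`: `K = k(t)`, `K° = K`).
[cite: Temkin2013, Thm. 1.3.2 in height 0 = proof of Thm. 4.1.1, first sentence, p. 47] -/
theorem Temkin2013RelHeightLE.zero (hN : NoetherFiniteIntegralClosure.{u}) :
    Temkin2013RelHeightLE.{u} 0 := by
  intro k K _ _ _ hfg O hO hdim A hAO hAfg hAfr
  have hOtop : O = ⊤ :=
    valuationSubring_eq_top_of_ringKrullDim_le_zero O (by exact_mod_cast hdim)
  subst hOtop
  obtain ⟨L, _, _, _, _, hfin, hpi, l, hlfin, hlpi, -, -, hsmooth⟩ :=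
    exists_purelyInseparable_isSeparablyGenerated k K hfg
  exact temkin2013RelConclusion_top hN k K A hAfg hAfr L l

end Literature.AlgebraicGeometry.Resolution

end
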